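import Mathlib
import HarnessLib
import Literature.Computability.Complexity.CNF
import Literature.Computability.Complexity.PNPWave0

/-!
# PneNP / OverlapGapAlgebra — `SearchHardWindow`: the unconditional sign-oblivious rung

Support for crux `stmt-PneNP-2460` (`Summit.PneNP.PneNP.Theses.OverlapGapAlgebra.SearchHardWindow`).
Companion of `Theorems/OverlapGapAlgebraSearchHardWindowQueryRung.lean` (a successful solver must
read all but `O(1)` clauses); here: it must read their POLARITIES.

* `shwS_card_solved_eq` — if `A : instances → assignments` depends only on the variable skeleton
  `(i, j) ↦ (Φ i j).1` of the literal array (it may read the whole hypergraph, with unbounded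
  computation, but not the signs), then EXACTLY
  `#{Φ : A Φ satisfies Φ} · 2^{k m} = (2^k - 1)^m · #instances`, i.e. the success ratio is
  `(1 - 2^{-k})^m` — the same as for a constant output. Proof: fibre over the skeleton; on a fibre
  `A` is constant `= σ`, the `k m` signs are free, and clause `i` fails for exactly one of its
  `2^k` sign patterns (`b_j = ¬ σ (v_j)` for all `j`).
* `shwS_ratio_eventually_le` / `shwS_hardnessConjunct_of_signOblivious` — hence for `α > 0`
  (so `m = ⌊αn⌋ → ∞`) every sign-oblivious `f : List Bool → List Bool` satisfies the hardness
  conjunct of the crux verbatim, at every `k`.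

No new definitions; axioms `propext`, `Classical.choice`, `Quot.sound`.
-/

set_option linter.dupNamespace false -- `Summit.PneNP.PneNP.…`: summit = sub-problem (D-0017)

namespace Summit.PneNP.PneNP.Theorems

open Finset Filter
open scoped Classical

section Count

variable {m k n : ℕ}

/-- The clauses with a prescribed variable skeleton `w : Fin k → Fin n` form a box of `2^k` sign
patterns. -/
theorem shwS_card_skeletonBox (w : Fin k → Fin n) :
    ((univ : Finset (Fin k → Fin n × Bool)).filter fun c => ∀ j, (c j).1 = w j).card = 2 ^ k := by
  have h : ((univ : Finset (Fin k → Fin n × Bool)).filter fun c => ∀ j, (c j).1 = w j)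
      = Fintype.piFinset fun j => ({(w j, false), (w j, true)} : Finset (Fin n × Bool)) := by
    ext c
    simp only [mem_filter, mem_univ, true_and, Fintype.mem_piFinset, mem_insert, mem_singleton]
    constructor
    · intro hc j
      rcases hb : (c j).2 with _ | _
      · left; exact Prod.ext (hc j) hb
      · right; exact Prod.ext (hc j) hb
    · intro hc j
      rcases hc j with h | h <;> rw [h]
  rw [h, Fintype.card_piFinset]
  have h2 : ∀ j, (({(w j, false), (w j, true)} : Finset (Fin n × Bool))).card = 2 := fun j => by
    rw [card_insert_of_notMem (by simp), card_singleton]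
  simp only [h2, prod_const, card_univ, Fintype.card_fin]

/-- Among the clauses with skeleton `w`, exactly `2^k - 1` are satisfied by a fixed assignment
`σ`: the only failing sign pattern is `b_j = ¬ σ (w j)`. -/
theorem shwS_card_skeletonBox_sat (w : Fin k → Fin n) (σ : Fin n → Bool) :
    ((univ : Finset (Fin k → Fin n × Bool)).filter fun c =>
        (∀ j, (c j).1 = w j) ∧ ∃ j, σ (c j).1 = (c j).2).card = 2 ^ k - 1 := by
  have hsplit := Finset.card_filter_add_card_filter_not
    (s := (univ : Finset (Fin k → Fin n × Bool)).filter fun c => ∀ j, (c j).1 = w j)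
    (fun c => ∃ j, σ (c j).1 = (c j).2)
  rw [shwS_card_skeletonBox, Finset.filter_filter, Finset.filter_filter] at hsplit
  -- the failing pattern is unique
  have hone : ((univ : Finset (Fin k → Fin n × Bool)).filter fun c =>
      (∀ j, (c j).1 = w j) ∧ ¬ ∃ j, σ (c j).1 = (c j).2).card = 1 := by
    rw [card_eq_one]
    refine ⟨fun j => (w j, !σ (w j)), ?_⟩
    ext c
    simp only [mem_filter, mem_univ, true_and, mem_singleton, not_exists]
    constructor
    · rintro ⟨hw, hσ⟩
      funext j
      refine Prod.ext (hw j) ?_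
      have := hσ j
      rw [hw j] at this
      revert this
      cases σ (w j) <;> cases (c j).2 <;> simp
    · rintro rfl
      refine ⟨fun j => rfl, fun j => ?_⟩
      show ¬ σ (w j) = !σ (w j)
      cases σ (w j) <;> decide
  omega

/-- **Sign-oblivious solvers, exact count.** If `A` depends only on the variable skeleton of the
instance, then `#{Φ : A Φ satisfies Φ} = n^{k m} · (2^k - 1)^m`. -/
theorem shwS_card_solved_eq (A : (Fin m → Fin k → Fin n × Bool) → (Fin n → Bool))
    (hA : ∀ Φ Ψ : Fin m → Fin k → Fin n × Bool, (∀ i j, (Φ i j).1 = (Ψ i j).1) → A Φ = A Ψ) :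
    ((univ : Finset (Fin m → Fin k → Fin n × Bool)).filter fun Φ =>
        ∀ i, ∃ j, A Φ (Φ i j).1 = (Φ i j).2).card = (n ^ k) ^ m * (2 ^ k - 1) ^ m := by
  set G : Finset (Fin m → Fin k → Fin n × Bool) :=
    univ.filter fun Φ => ∀ i, ∃ j, A Φ (Φ i j).1 = (Φ i j).2 with hG
  -- skeleton map and the canonical instance over a skeleton
  set skel : (Fin m → Fin k → Fin n × Bool) → (Fin m → Fin k → Fin n) :=
    fun Φ i j => (Φ i j).1 with hskel
  set can : (Fin m → Fin k → Fin n) → (Fin m → Fin k → Fin n × Bool) :=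
    fun V i j => (V i j, false) with hcan
  have skel_can : ∀ V, skel (can V) = V := fun V => rfl
  -- fibre of `G` over a skeleton `V` is a box of per-clause sets
  have fiber : ∀ V, (G.filter fun Φ => skel Φ = V) = Fintype.piFinset fun i =>
      (univ : Finset (Fin k → Fin n × Bool)).filter fun c =>
        (∀ j, (c j).1 = V i j) ∧ ∃ j, A (can V) (c j).1 = (c j).2 := by
    intro V
    ext Φ
    simp only [hG, mem_filter, mem_univ, true_and, Fintype.mem_piFinset]
    constructor
    · rintro ⟨hgood, hV⟩ i
      have hAeq : A Φ = A (can V) := hA Φ (can V) fun i j => by rw [← hV]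
      refine ⟨fun j => by rw [← hV], ?_⟩
      rw [← hAeq]
      exact hgood i
    · intro h
      have hV : skel Φ = V := funext fun i => funext fun j => (h i).1 j
      have hAeq : A Φ = A (can V) := hA Φ (can V) fun i j => by rw [← hV]
      refine ⟨fun i => ?_, hV⟩
      rw [hAeq]
      exact (h i).2
  have hGsum := Finset.card_eq_sum_card_fiberwise (f := skel) (s := G) (t := univ)
    fun _ _ => mem_coe.2 (mem_univ _)
  rw [hGsum]
  simp_rw [fiber, Fintype.card_piFinset, shwS_card_skeletonBox_sat, prod_const, card_univ,
    Fintype.card_fin, sum_const, card_univ, smul_eq_mul, Fintype.card_fun, Fintype.card_fin]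

/-- The success ratio of a sign-oblivious solver is exactly `(1 - 2^{-k})^m` (for `n ≥ 1`). -/
theorem shwS_ratio_eq (hn : 1 ≤ n) (A : (Fin m → Fin k → Fin n × Bool) → (Fin n → Bool))
    (hA : ∀ Φ Ψ : Fin m → Fin k → Fin n × Bool, (∀ i j, (Φ i j).1 = (Ψ i j).1) → A Φ = A Ψ) :
    (((univ : Finset (Fin m → Fin k → Fin n × Bool)).filter fun Φ =>
        ∀ i, ∃ j, A Φ (Φ i j).1 = (Φ i j).2).card : ℝ)
      / Fintype.card (Fin m → Fin k → Fin n × Bool) = (1 - (1 / 2 : ℝ) ^ k) ^ m := by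
  have hN : (Fintype.card (Fin m → Fin k → Fin n × Bool) : ℝ) = ((n : ℝ) ^ k) ^ m * (2 ^ k) ^ m := by
    rw [Fintype.card_fun, Fintype.card_fun, Fintype.card_prod, Fintype.card_fin, Fintype.card_fin,
      Fintype.card_bool, Fintype.card_fin]
    push_cast; ring
  have hn0 : (0 : ℝ) < n := by exact_mod_cast hn
  have hpos : (0 : ℝ) < ((n : ℝ) ^ k) ^ m * (2 ^ k) ^ m := by positivity
  rw [hN, div_eq_iff hpos.ne', shwS_card_solved_eq A hA]
  have h1 : (1 : ℕ) ≤ 2 ^ k := Nat.one_le_two_pow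
  push_cast [Nat.cast_sub h1]
  have hq : (2 : ℝ) ^ k - 1 = (1 - (1 / 2 : ℝ) ^ k) * 2 ^ k := by
    rw [one_div, inv_pow]
    have : (2 : ℝ) ^ k ≠ 0 := by positivity
    field_simp
  rw [hq, mul_pow]; ring

end Count

section Asymptotic

open Literature.Computability.Complexity

/-- **Sign-oblivious rung, asymptotic form (abstract solvers, any `k`, `α > 0`).** -/
theorem shwS_ratio_eventually_le (k : ℕ) {α : ℝ} (hα : 0 < α)
    (A : (n m : ℕ) → (Fin m → Fin k → Fin n × Bool) → (Fin n → Bool))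
    (hA : ∀ᶠ n : ℕ in atTop, ∀ m : ℕ, m = ⌊α * n⌋₊ →
      ∀ Φ Ψ : Fin m → Fin k → Fin n × Bool, (∀ i j, (Φ i j).1 = (Ψ i j).1) → A n m Φ = A n m Ψ)
    (ε : ℝ) (hε : 0 < ε) :
    ∀ᶠ n : ℕ in atTop, ∀ m : ℕ, m = ⌊α * n⌋₊ →
      (((univ : Finset (Fin m → Fin k → Fin n × Bool)).filter fun Φ =>
          ∀ i, ∃ j, A n m Φ (Φ i j).1 = (Φ i j).2).card : ℝ)
        / Fintype.card (Fin m → Fin k → Fin n × Bool) ≤ ε := by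
  have h0 : (0 : ℝ) ≤ 1 - (1 / 2 : ℝ) ^ k :=
    sub_nonneg.2 (pow_le_one₀ (by norm_num) (by norm_num))
  have h1 : 1 - (1 / 2 : ℝ) ^ k < 1 := sub_lt_self _ (by positivity)
  have hfl : Tendsto (fun n : ℕ => ⌊α * n⌋₊) atTop atTop :=
    tendsto_nat_floor_atTop.comp (Tendsto.const_mul_atTop hα tendsto_natCast_atTop_atTop)
  have hpow := ((tendsto_pow_atTop_nhds_zero_of_lt_one h0 h1).comp hfl).eventually (ge_mem_nhds hε)
  filter_upwards [hA, hpow, eventually_ge_atTop 1] with n hn hsmall hn1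
  intro m hm
  rw [shwS_ratio_eq hn1 (A n m) (hn m hm), hm]
  exact hsmall

/-- **Sign-oblivious rung for the crux's hardness conjunct (verbatim shape).** For ANY
`f : List Bool → List Bool` (no complexity hypothesis) whose decoded assignment, eventually in
`n`, does not depend on the polarities of the literals of the instance, and any `α > 0`, the
hardness conjunct of `SearchHardWindow` holds for `f` at `(k, α)`. -/
theorem shwS_hardnessConjunct_of_signOblivious (k : ℕ) {α : ℝ} (hα : 0 < α)
    (f : List Bool → List Bool)
    (hf : ∀ᶠ n : ℕ in atTop, ∀ m : ℕ, m = ⌊α * n⌋₊ →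
      ∀ Φ Ψ : Fin m → Fin k → Fin n × Bool, (∀ i j, (Φ i j).1 = (Ψ i j).1) → ∀ v : Fin n,
        (f (encodingCNF.encode (List.ofFn fun a => List.ofFn fun b =>
            (((Φ a b).1 : ℕ), (Φ a b).2)))).getD v false
          = (f (encodingCNF.encode (List.ofFn fun a => List.ofFn fun b =>
            (((Ψ a b).1 : ℕ), (Ψ a b).2)))).getD v false) :
    ∀ ε : ℝ, 0 < ε → ∀ᶠ n : ℕ in Filter.atTop, ∀ m : ℕ, m = ⌊α * n⌋₊ →
      ((Finset.univ.filter fun Φ : Fin m → Fin k → Fin n × Bool => ∀ i, ∃ j,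
          (f (Literature.Computability.Complexity.encodingCNF.encode (List.ofFn fun a =>
            List.ofFn fun b => (((Φ a b).1 : ℕ), (Φ a b).2)))).getD (Φ i j).1 false =
              (Φ i j).2).card : ℝ) / Fintype.card (Fin m → Fin k → Fin n × Bool) ≤ ε := by
  intro ε hε
  have key := shwS_ratio_eventually_le k hα
    (fun n m Φ v => (f (encodingCNF.encode (List.ofFn fun a => List.ofFn fun b =>
      (((Φ a b).1 : ℕ), (Φ a b).2)))).getD v false)
    (hf.mono fun n hn m hm Φ Ψ h => funext fun v => hn m hm Φ Ψ h v) ε hε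
  exact key

end Asymptotic

end Summit.PneNP.PneNP.Theorems
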